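import Mathlib.Analysis.SpecialFunctions.Log.Base
import Literature.Computability.AlgebraicComplexity.MatrixMultiplicationExponentInf
import HarnessLib

/-!
# Laderman 1976: "`log₂ 7 ≈ log₃ 21.8`" — only `21` or fewer multiplications for `3 × 3` improve on Strassen

Topic `Literature/Computability/AlgebraicComplexity`, over `tensorRank` / `matMulTensor` / `omega` of
`MatrixMultiplicationExponent.lean` and the exponent bound `ω ≤ log_q R(⟨q,q,q⟩)`
(`advxxz2025_omega_le_logb_of_tensorRank_le`, `MatrixMultiplicationExponentInf.lean`; Bläser 2013,
Thm. 5.9); companion of `SmallFormatRankLaderman.lean` (Laderman's `R(⟨3,3,3⟩) ≤ 23`).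

Source: J. D. Laderman, *A noncommutative algorithm for multiplying `3 × 3` matrices using `23`
multiplications*, Bull. Amer. Math. Soc. 82 (1976) 126–128 [Laderman1976], p. 126, verbatim:

> "In multiplying `3 × 3` matrices, since `log₂ 7 ≈ log₃ 21.8`, a noncommutative algorithm requiring
> `21` or fewer multiplications is needed to improve on Strassen's asymptotic result."

## What is proved (everything; no named facts)

* `logb_three_21_lt_logb_two_7` : `log₃ 21 < log₂ 7` and `logb_two_7_lt_logb_three_22` :
  `log₂ 7 < log₃ 22` — the integer content of "`log₂ 7 ≈ log₃ 21.8`" (`3^{log₂ 7} = 21.84…` lies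
  strictly between `21` and `22`), via the rational cuts `14/5` and `45/16` and the integer
  comparisons `21⁵ < 3¹⁴`, `2¹⁴ < 7⁵`, `7¹⁶ < 2⁴⁵`, `3⁴⁵ < 22¹⁶` (`norm_num`);
* `laderman1976_exponent_threshold` — the printed sentence: a `⟨3,3,3⟩`-algorithm with `r ≤ 21`
  multiplications over a field `K` gives `ω(K) ≤ log₃ r < log₂ 7` (Strassen's exponent bound), whereas
  for `r ≥ 22` the recursion exponent `log₃ r` exceeds `log₂ 7`
  (`logb_two_7_lt_logb_three_of_le`); in particular neither Laderman's `23` nor a hypothetical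
  rank-`22` scheme improves on Strassen's bound by `3 × 3` recursion alone.

HONEST FRAMING: elementary numerics recorded because the sentence is the printed motivation for the
rank-`21`/`22` questions about `⟨3,3,3⟩`; nothing here bears on whether such schemes exist.

## References

* J. D. Laderman, Bull. Amer. Math. Soc. 82 (1976) 126–128, p. 126 (the quoted sentence).
  [Laderman1976]
* M. Bläser, *Fast Matrix Multiplication*, Theory of Computing Graduate Surveys 5 (2013), Thm. 5.9
  (`R(⟨q,q,q⟩) ≤ r ⇒ ω ≤ log_q r`). [Blaser2013]
-/

noncomputable section

namespace Literature.Computability.AlgebraicComplexity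

/-- `log₃ 21 < 14/5`, from `21⁵ < 3¹⁴`. [cite: Laderman1976, p. 126] -/
private theorem logb_three_21_lt : Real.logb 3 21 < 14 / 5 := by
  have h : Real.log ((21 : ℝ) ^ 5) < Real.log ((3 : ℝ) ^ 14) :=
    Real.log_lt_log (by positivity) (by norm_num)
  rw [Real.log_pow, Real.log_pow] at h
  push_cast at h
  rw [Real.logb, div_lt_iff₀ (Real.log_pos (by norm_num))]
  linarith

/-- `14/5 < log₂ 7`, from `2¹⁴ < 7⁵`. [cite: Laderman1976, p. 126] -/
private theorem lt_logb_two_7 : (14 : ℝ) / 5 < Real.logb 2 7 := by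
  have h : Real.log ((2 : ℝ) ^ 14) < Real.log ((7 : ℝ) ^ 5) :=
    Real.log_lt_log (by positivity) (by norm_num)
  rw [Real.log_pow, Real.log_pow] at h
  push_cast at h
  rw [Real.logb, lt_div_iff₀ (Real.log_pos (by norm_num))]
  linarith

/-- `log₂ 7 < 45/16`, from `7¹⁶ < 2⁴⁵`. [cite: Laderman1976, p. 126] -/
private theorem logb_two_7_lt : Real.logb 2 7 < 45 / 16 := by
  have h : Real.log ((7 : ℝ) ^ 16) < Real.log ((2 : ℝ) ^ 45) :=
    Real.log_lt_log (by positivity) (by norm_num)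
  rw [Real.log_pow, Real.log_pow] at h
  push_cast at h
  rw [Real.logb, div_lt_iff₀ (Real.log_pos (by norm_num))]
  linarith

/-- `45/16 < log₃ 22`, from `3⁴⁵ < 22¹⁶`. [cite: Laderman1976, p. 126] -/
private theorem lt_logb_three_22 : (45 : ℝ) / 16 < Real.logb 3 22 := by
  have h : Real.log ((3 : ℝ) ^ 45) < Real.log ((22 : ℝ) ^ 16) :=
    Real.log_lt_log (by positivity) (by norm_num)
  rw [Real.log_pow, Real.log_pow] at h
  push_cast at h
  rw [Real.logb, lt_div_iff₀ (Real.log_pos (by norm_num))]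
  linarith

/-- **`log₃ 21 < log₂ 7`**: `21` multiplications for `3 × 3` would beat Strassen's exponent
("`log₂ 7 ≈ log₃ 21.8`", lower side). [cite: Laderman1976, p. 126] -/
theorem logb_three_21_lt_logb_two_7 : Real.logb 3 21 < Real.logb 2 7 :=
  logb_three_21_lt.trans lt_logb_two_7

/-- **`log₂ 7 < log₃ 22`**: `22` multiplications for `3 × 3` do not beat Strassen's exponent by
recursion ("`log₂ 7 ≈ log₃ 21.8`", upper side). [cite: Laderman1976, p. 126] -/
theorem logb_two_7_lt_logb_three_22 : Real.logb 2 7 < Real.logb 3 22 :=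
  logb_two_7_lt.trans lt_logb_three_22

/-- For every `r ≥ 22` the `3 × 3` recursion exponent `log₃ r` exceeds Strassen's `log₂ 7`.
[cite: Laderman1976, p. 126] -/
theorem logb_two_7_lt_logb_three_of_le {r : ℕ} (hr : 22 ≤ r) : Real.logb 2 7 < Real.logb 3 r := by
  refine logb_two_7_lt_logb_three_22.trans_le ?_
  exact Real.logb_le_logb_of_le (by norm_num) (by norm_num) (by exact_mod_cast hr)

/-- For every `r ≤ 21` (and `r ≥ 1`) the `3 × 3` recursion exponent `log₃ r` is below Strassen's
`log₂ 7`. [cite: Laderman1976, p. 126] -/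
theorem logb_three_lt_logb_two_7_of_le {r : ℕ} (hr1 : 1 ≤ r) (hr : r ≤ 21) :
    Real.logb 3 r < Real.logb 2 7 := by
  refine lt_of_le_of_lt ?_ logb_three_21_lt_logb_two_7
  exact Real.logb_le_logb_of_le (by norm_num) (by exact_mod_cast hr1) (by exact_mod_cast hr)

/-- **Laderman 1976, p. 126**: "since `log₂ 7 ≈ log₃ 21.8`, a noncommutative algorithm requiring `21`
or fewer multiplications is needed to improve on Strassen's asymptotic result" — over any field `K`:
(i) a `⟨3,3,3⟩`-scheme with `r ≤ 21` products gives `ω(K) ≤ log₃ r < log₂ 7`; (ii) for `r ≥ 22`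
(Laderman's `23`, or a hypothetical rank-`22` scheme) the recursion bound `log₃ r` is worse than
Strassen's `log₂ 7`. (The exponent bound `R(⟨3,3,3⟩) ≤ r ⇒ ω ≤ log₃ r` is Bläser 2013, Thm. 5.9, in
the tree.) [cite: Laderman1976, p. 126] -/
theorem laderman1976_exponent_threshold (K : Type) [Field K] :
    (∀ r : ℕ, 1 ≤ r → r ≤ 21 → tensorRank (matMulTensor K 3 3 3) ≤ r →
        omega K ≤ Real.logb 3 r ∧ Real.logb 3 r < Real.logb 2 7) ∧
      (∀ r : ℕ, 22 ≤ r → Real.logb 2 7 < Real.logb 3 r) :=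
  ⟨fun _ hr1 hr21 h =>
    ⟨advxxz2025_omega_le_logb_of_tensorRank_le K (by norm_num) h,
      logb_three_lt_logb_two_7_of_le hr1 hr21⟩,
    fun _ hr => logb_two_7_lt_logb_three_of_le hr⟩

/-- In particular a rank-`21` scheme for `⟨3,3,3⟩` over a field `K` would give `ω(K) < log₂ 7`.
[cite: Laderman1976, p. 126] -/
theorem omega_lt_logb_two_7_of_tensorRank_three_le_21 (K : Type) [Field K]
    (h : tensorRank (matMulTensor K 3 3 3) ≤ 21) : omega K < Real.logb 2 7 :=
  (advxxz2025_omega_le_logb_of_tensorRank_le K (by norm_num) h).trans_lt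
    logb_three_21_lt_logb_two_7

end Literature.Computability.AlgebraicComplexity
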